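import Literature.NumberTheory.Rogawski1990.LocalStableClassesNonsplitRankTwoIrreducible   -- ★ B-p14 (F11-a): ONE class for irreducible `χ_g`
import Literature.NumberTheory.Automorphic.UnitaryGroupLocalCongr                       -- ★ `adelicForm_map_adeleToLocal`
import Literature.NumberTheory.Automorphic.UnitaryGroupNonsplitPlace                    -- ★ `LocalRing.isField_of_smul_eq`, `PlacesOver.subsingleton_of_smul_eq`
import HarnessLib

/-!
# One stable class for the irreducible `U(Φ₂)` torus — the STUB-FRAME ADAPTER («no root at `w`» ⇒ irreducible over `E_v`; `Φ₂` discharged)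
# (Flicker 1998, p. 97: «the stable conjugacy class of `t` in `H` consists of a single conjugacy class»; Rogawski 1990, §3.6 p. 31)

Topic `NumberTheory/Rogawski1990`; namespace `Literature.NumberTheory.Rogawski1990`.  THEOREMS ONLY (no definition, no instance, no notation, no named fact, no `sorry`;
count-neutral).  Cell `pub/hodgecm-mathlib`, F0∕P3a road «D-N7-inert», line «N7nsCount» ED. 1.3 (`stub_countIrredClause`; architect A-p06 (g26); LEAD F0P3a-plan (g9)
2026-09-01T05:08Z deal (F11-d)(α)): B-p14 (g30)'s ★ (F11-a) `stableOrbitalIntegralRel_eq_classOrbitalIntegral_of_irreducible` READ IN THE STUB FRAME — its `hirr :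
Irreducible χ_g` (over `E_v = L ⊗ L⁺_v`) from the stub's `hirr : ¬ ∃ x : L_w, IsRoot χ_{g,w} x` (no root at `w`), and its `hΦ₂ hΦ₂d` discharged (the local form of `Φ₂` is
the literal `antidiag(1, 1)`).  Consumer: B-p10 (g24) (F11-d) via ★ (D1) `stableOrbitalIntegralRel_indicator_eq_classOrbitalIntegral_of_unique`.  HONEST LABEL: HC_CM is
proved only modulo the printed citations until rung 0 closes; bookkeeping here.

THE MATHEMATICS.  At a NON-SPLIT place `v` the ring `E_v = Π_{w∣v} L_w` is the field `L_w` (one factor), so a root of `χ_g` in `E_v` is a root of `χ_{g,w} = χ_g.map eval_w`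
in `L_w`; a monic QUADRATIC over a field with no root is irreducible (Mathlib `Monic.irreducible_iff_roots_eq_zero_of_degree_le_three`) —
**`irreducible_charpoly_fst_of_not_exists_isRoot`**.  Hence ★ (F11-a): the stable class of `γ_H = (g, u)` in `H_v` is ONE class and `Φ^st(γ_H, f) = Φ(⟦γ_H⟧, f)` for
every `f` and every orbital-measure family (**`stableOrbitalIntegralRel_eq_classOrbitalIntegral_of_not_exists_isRoot`**).

## References
* [Flicker1998UnitaryFL] Y. Z. Flicker, *Elementary proof of the fundamental lemma for a unitary group*, Canad. J. Math. 50 (1998), p. 97 (lines before Thm. 18).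
* [Rogawski1990] J. D. Rogawski, *Automorphic Representations of Unitary Groups in Three Variables*, Ann. of Math. Stud. 123 (1990), §3.6 p. 31; §4.1 (4.1.1) p. 39.
-/

set_option autoImplicit false

noncomputable section

open Matrix NumberField IsDedekindDomain Polynomial
open scoped MatrixGroups

namespace Literature.NumberTheory.Rogawski1990

open Literature.NumberTheory.Automorphic Literature.NumberTheory.Automorphic.UnitaryGroup Literature.NumberTheory.GaloisRepresentations

variable (L : Type) [Field L] [NumberField L] [IsCMField L] (v : HeightOneSpectrum (𝓞 ↥(maximalRealSubfield L)))
  (w : PlacesOver L v) (hw : IsCMField.complexConj L • w.1 = w.1)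

/-! ## §1 No root at `w` ⇒ irreducible over `E_v` -/

include hw in
/-- **NO ROOT AT `w` ⇒ `χ_g` IRREDUCIBLE OVER `E_v`** (non-split `v`): `E_v = L_w` is a field, a root of `χ_g` in `E_v` reads at `w` as a root of `χ_{g,w}`, and a monic quadratic
over a field without roots is irreducible. [cite: Rogawski1990, §3.6 p. 31] -/
theorem irreducible_charpoly_fst_of_not_exists_isRoot
    {γH : (cmDatum L 2 (Matrix.of fun i j : Fin 2 => if i.val + j.val + 1 = 2 then (1 : L) else 0)).Local v ×
      (cmDatum L 1 (Matrix.of fun i j : Fin 1 => if i.val + j.val + 1 = 1 then (1 : L) else 0)).Local v}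
    (hirr : ¬ ∃ x : w.1.adicCompletion L, (((γH.1.val : GL (Fin 2) (LocalRing L v)).val.map
        (Pi.evalRingHom (fun w' : PlacesOver L v => w'.1.adicCompletion L) w)).charpoly).IsRoot x) :
    Irreducible ((γH.1.val : GL (Fin 2) (LocalRing L v)).val.charpoly) := by
  have hc1 : IsCMField.complexConj L ≠ 1 := IsCMField.complexConj_ne_one L
  letI : Field (LocalRing L v) := (LocalRing.isField_of_smul_eq (IsCMField.complexConj L) hc1 w hw).toField
  set A : Matrix (Fin 2) (Fin 2) (LocalRing L v) := (γH.1.val : GL (Fin 2) (LocalRing L v)).val with hA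
  have hmonic : A.charpoly.Monic := Matrix.charpoly_monic A
  have hdeg : A.charpoly.natDegree = 2 := by rw [Matrix.charpoly_natDegree_eq_dim, Fintype.card_fin]
  rw [hmonic.irreducible_iff_roots_eq_zero_of_degree_le_three (by rw [hdeg]) (by rw [hdeg]; norm_num)]
  refine Multiset.eq_zero_of_forall_notMem fun r hr => hirr ⟨r w, ?_⟩
  have hroot : A.charpoly.IsRoot r := (Polynomial.mem_roots hmonic.ne_zero).1 hr
  rw [Matrix.charpoly_map, Polynomial.IsRoot.def, Polynomial.eval_map]
  have h := Polynomial.eval₂_at_apply (p := A.charpoly) (Pi.evalRingHom (fun w' : PlacesOver L v => w'.1.adicCompletion L) w) r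
  rw [hroot.eq_zero, map_zero] at h
  exact h

/-! ## §2 The local form of `Φ₂` (hermitian, unit determinant) and the one-class head in the stub frame -/

omit [IsCMField L] in
/-- The local form of `Φ₂` over `E_v` is the literal `antidiag(1, 1)`. [cite: Rogawski1990, §3.5 p. 29] -/
private theorem antidiagTwo_map_algebraMap'' :
    (Matrix.of fun i j : Fin 2 => if i.val + j.val + 1 = 2 then (1 : L) else 0).map (algebraMap L (LocalRing L v)) =
      Matrix.of fun i j : Fin 2 => if i.val + j.val + 1 = 2 then (1 : LocalRing L v) else 0 := by
  ext i j
  simp only [map_apply, of_apply]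
  split_ifs <;> simp

/-- **`(Φ₂)_v` is hermitian for `c ⊗ 1`** (its entries are `0, 1`). [cite: Rogawski1990, §3.5 p. 29] -/
theorem adelicForm_antidiagTwo_local_hermitian :
    ((((adelicForm L 2 (Matrix.of fun i j : Fin 2 => if i.val + j.val + 1 = 2 then (1 : L) else 0)).map (adeleToLocal L v)).map
        (conjLocal L (IsCMField.complexConj L) v))ᵀ =
      (adelicForm L 2 (Matrix.of fun i j : Fin 2 => if i.val + j.val + 1 = 2 then (1 : L) else 0)).map (adeleToLocal L v)) := by
  rw [adelicForm_map_adeleToLocal, antidiagTwo_map_algebraMap'']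
  ext i j
  fin_cases i <;> fin_cases j <;> simp [Matrix.of_apply]

omit [IsCMField L] in
/-- **`det (Φ₂)_v` is a unit** (`= −1`). [cite: Rogawski1990, §3.5 p. 29] -/
theorem isUnit_det_adelicForm_antidiagTwo_local :
    IsUnit ((adelicForm L 2 (Matrix.of fun i j : Fin 2 => if i.val + j.val + 1 = 2 then (1 : L) else 0)).map (adeleToLocal L v)).det := by
  rw [adelicForm_map_adeleToLocal, antidiagTwo_map_algebraMap'', Matrix.det_fin_two]
  simp [Matrix.of_apply]

include hw in
/-- **(F11-d)(α) ONE CLASS IN THE STUB FRAME**: for `γ_H = (g, u) ∈ H_v` at a non-split `v` (`w ∣ v`, `c • w = w`) whose `χ_{g,w}` has NO ROOT in `L_w` (the stub's `hirr`),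
`Φ^st(γ_H, f) = Φ(⟦γ_H⟧, f)` for EVERY `f` and every orbital-measure family — ★ B-p14 (F11-a) `stableOrbitalIntegralRel_eq_classOrbitalIntegral_of_irreducible` with its
three premises discharged (§1, §2). [cite: Flicker1998UnitaryFL, p. 97] [cite: Rogawski1990, §3.6 p. 31; §4.1 (4.1.1) p. 39] -/
theorem stableOrbitalIntegralRel_eq_classOrbitalIntegral_of_not_exists_isRoot
    [∀ x : (cmDatum L 2 (Matrix.of fun i j : Fin 2 => if i.val + j.val + 1 = 2 then (1 : L) else 0)).Local v ×
      (cmDatum L 1 (Matrix.of fun i j : Fin 1 => if i.val + j.val + 1 = 1 then (1 : L) else 0)).Local v,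
      MeasurableSpace (((cmDatum L 2 (Matrix.of fun i j : Fin 2 => if i.val + j.val + 1 = 2 then (1 : L) else 0)).Local v ×
        (cmDatum L 1 (Matrix.of fun i j : Fin 1 => if i.val + j.val + 1 = 1 then (1 : L) else 0)).Local v) ⧸
        Subgroup.centralizer ({x} : Set ((cmDatum L 2 (Matrix.of fun i j : Fin 2 => if i.val + j.val + 1 = 2 then (1 : L) else 0)).Local v ×
          (cmDatum L 1 (Matrix.of fun i j : Fin 1 => if i.val + j.val + 1 = 1 then (1 : L) else 0)).Local v)))]
    (mH : OrbitalMeasureFamily ((cmDatum L 2 (Matrix.of fun i j : Fin 2 => if i.val + j.val + 1 = 2 then (1 : L) else 0)).Local v ×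
      (cmDatum L 1 (Matrix.of fun i j : Fin 1 => if i.val + j.val + 1 = 1 then (1 : L) else 0)).Local v))
    (fH : ((cmDatum L 2 (Matrix.of fun i j : Fin 2 => if i.val + j.val + 1 = 2 then (1 : L) else 0)).Local v ×
      (cmDatum L 1 (Matrix.of fun i j : Fin 1 => if i.val + j.val + 1 = 1 then (1 : L) else 0)).Local v) → ℂ)
    {γH : (cmDatum L 2 (Matrix.of fun i j : Fin 2 => if i.val + j.val + 1 = 2 then (1 : L) else 0)).Local v ×
      (cmDatum L 1 (Matrix.of fun i j : Fin 1 => if i.val + j.val + 1 = 1 then (1 : L) else 0)).Local v}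
    (hirr : ¬ ∃ x : w.1.adicCompletion L, (((γH.1.val : GL (Fin 2) (LocalRing L v)).val.map
        (Pi.evalRingHom (fun w' : PlacesOver L v => w'.1.adicCompletion L) w)).charpoly).IsRoot x) :
    stableOrbitalIntegralRel (IsLocalStablyConjH L v) mH fH γH = classOrbitalIntegral mH fH (ConjClasses.mk γH) :=
  stableOrbitalIntegralRel_eq_classOrbitalIntegral_of_irreducible L v w hw (adelicForm_antidiagTwo_local_hermitian L v)
    (isUnit_det_adelicForm_antidiagTwo_local L v) mH fH γH (irreducible_charpoly_fst_of_not_exists_isRoot L v w hw hirr)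

end Literature.NumberTheory.Rogawski1990

end
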